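import Summits.ResolutionOfSingularities.ResolutionOfSingularities.Theorems.EquisingularLiftEquisingularLiftNatLargeCharSpreadCentres
import Literature.AlgebraicGeometry.Resolution.SpreadModelDataSpread
import Literature.AlgebraicGeometry.Resolution.RegularSubschemeLocallyIrreducible
import Literature.AlgebraicGeometry.Resolution.ProjectiveSpaceRegular
import Literature.AlgebraicGeometry.Resolution.AlterationsLemma32
import HarnessLib

/-!
# EL♮(3) / EL♮(n), RUNG LC «large characteristic» — brick (B3′)(s3): the ideal inclusion `𝓣 ≤ C` («the centre lies in the running strict
# transform») read off the K-side set-level word and SPREAD to every base `A → B` inverting some `a ≠ 0`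

leafhand-res-equisingularlift-3 g0 (prover, 2026-08-31; one-generation line-first hand on stmt-ResolutionOfSingularities-20148 / -20038 /
-15660, cell `pub/decomp-res`).  Crux `EquisingularLiftNatThree` (`stmt-…-20148`; uniform in `n`, so also `stmt-…-20038`), line W4.5(b), RUNG LC
(idea-2 g32 `Cruxes/EquisingularLiftNatThree/LARGE-CHAR-RUNG-idea2.md` v1.6 §(B3′)(s3) «`𝓘(T_i) ≤ C_i` (✓ `exists_comap_ι_le_comap_ι_of_generic`
SpreadIdealSheafInclusion :272, from the K-side face of ✓p731945)», (f2) «`C_{i,θ}.support ⊆ Y_{i,θ}` from (s3)» = ✓ `descTransformOK_E1_of_le`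
(…NatLargeCharFibreTokens)).  The K-side word ✓ `LargeChar.exists_centreSeq_descTransformOK` exports the SET-level token `supp C_K ⊆ Y_K = supp 𝓣_K`
of ✓ `DescTransformOK` together with SMOOTH (hence regular, hence reduced) centres; this file turns it into the IDEAL-level inclusion and spreads it,
DEF-FREE:

* `le_of_support_subset_of_isRegular` — **set-level E1 + regular centre ⇒ ideal-level**: `supp C ⊆ supp 𝓣` and `V(C)` regular ⇒ `𝓣 ≤ C`
  (`𝓣 ≤ √𝓣 = 𝓘(supp 𝓣) ≤ 𝓘(supp C) = C`; Mathlib `le_radical`, `vanishingIdeal_support`, `vanishingIdeal_antimono`, ✓ `eq_vanishingIdeal_support_of_isRegular`);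
  `le_of_support_subset_of_smooth` — the same with `V(C) → Spec K` SMOOTH over a field (the K-side currency ✓ `DescCentresSmoothOver`; smooth over the
  regular `Spec K` ⇒ regular, ✓ `Scheme.IsRegular.of_smooth`, ✓ `Scheme.isRegular_Spec`);
* ★ `exists_forall_comap_le_comap` — **spread of an ideal inclusion, packaged**: for `q : X → Spec A` of finite type over a Noetherian domain with
  generic fibre `j_K` (any cartesian square) and `I.comap j_K ≤ J.comap j_K`: `∃ a ≠ 0, ∀ B ∋ a⁻¹, ∀` cartesian `X_B = X ×_A Spec B` (`ι_B`),
  `I.comap ι_B ≤ J.comap ι_B` (✓ `exists_comap_ι_le_comap_ι_of_generic` over `q⁻¹D(a)`; `ι_B` factors through `q⁻¹D(a)` — Mathlib `IsOpenImmersion.lift`,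
  ✓ `specMap_mem_basicOpen_of_isUnit` — and `comap` is functorial and monotone).

USE: at stage `i` of the (B5) recursion, `(𝓣ᵢ.comap ι_B) ≤ (Cᵢ.comap ι_B)` on the base-changed word, whence the (E1) token on every k-fibre by
✓ `descTransformOK_E1_of_le`.  WHAT REMAINS of `hspread` (honest): the (B5) recursion itself (threading `𝓣ᵢ₊₁ = strictTransformIdeal πᵢ Cᵢ 𝓣ᵢ`,
identifying the K-side running sets with `supp 𝓣ᵢ,K` by ✓ `support_strictTransformIdeal_eq_closure`, multiplying the `a`'s of ✓ SpreadCentres / ✓ SpreadFlat /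
this file / END smoothness, and reading ✓ LC-FIB + ✓ (f2) + ✓ (f4) on each fibre) and the position token (f3) by fibre dimension.  EL♮(3) NOT proved; EL♮
NOT proved; resolution of singularities in positive characteristic NOT proved; nothing of [Hironaka2017] (a candidate under adjudication) is asserted or
used.  [OURS · bookkeeping over tree lemmas · standard axioms · DEF-FREE · `--supports stmt-ResolutionOfSingularities-20148 --as helper`, counted 0 ·
AI-written, weaker than expert review.] [cite: Grothendieck1966, EGA IV₃ §8–§9] (method; index only)
-/

set_option linter.dupNamespace false -- mandated namespace `Summit.<Summit>.<Problem>` of this single-conjunct summit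

noncomputable section

open CategoryTheory CategoryTheory.Limits AlgebraicGeometry TopologicalSpace PrimeSpectrum
open Literature.AlgebraicGeometry.Resolution
open AlgebraicGeometry.Scheme.IdealSheafData

namespace Summit.ResolutionOfSingularities.ResolutionOfSingularities.Cruxes.EquisingularLiftNat.Sections

/-! ## Set-level E1 + regular centre ⇒ ideal-level inclusion -/

section IdealLevel

variable {X : Scheme.{0}}

/-- **`supp C ⊆ supp 𝓣` and `V(C)` regular ⇒ `𝓣 ≤ C`**: `𝓣 ≤ √𝓣 = 𝓘(supp 𝓣) ≤ 𝓘(supp C) = C` (the last equality because a regular closed subscheme is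
reduced, ✓ `eq_vanishingIdeal_support_of_isRegular`). [folklore] -/
theorem le_of_support_subset_of_isRegular (T C : X.IdealSheafData) (hsupp : (C.support : Set X) ⊆ (T.support : Set X))
    (hreg : Scheme.IsRegular C.subscheme) : T ≤ C := by
  have h1 : T ≤ vanishingIdeal T.support := by rw [vanishingIdeal_support]; exact le_radical T
  have h2 : vanishingIdeal T.support ≤ vanishingIdeal C.support := vanishingIdeal_antimono hsupp
  have h3 : vanishingIdeal C.support = C := (eq_vanishingIdeal_support_of_isRegular C hreg).symm
  exact h1.trans (h3 ▸ h2)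

/-- … with `V(C) → Spec K` SMOOTH over a field `K` (the K-side currency ✓ `DescCentresSmoothOver`): smooth over the regular `Spec K` ⇒ regular
(✓ `Scheme.IsRegular.of_smooth`). [cite: Grothendieck1967, Prop. 17.5.8 (iii)] [folklore] -/
theorem le_of_support_subset_of_smooth {K : Type} [Field K] (T C : X.IdealSheafData) (qK : X ⟶ Spec (.of K)) [Smooth (C.subschemeι ≫ qK)]
    (hsupp : (C.support : Set X) ⊆ (T.support : Set X)) : T ≤ C := by
  haveI : IsRegularRing (CommRingCat.of K) := inferInstanceAs (IsRegularRing K)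
  have hK : Scheme.IsRegular (Spec (.of K)) := Scheme.isRegular_Spec (.of K)
  exact le_of_support_subset_of_isRegular T C hsupp (Scheme.IsRegular.of_smooth (C.subschemeι ≫ qK) hK)

end IdealLevel

/-! ## Spread of an ideal inclusion to every base inverting some `a ≠ 0` -/

section Spread

variable {A : Type} [CommRing A] [IsDomain A] [IsNoetherianRing A] (K : Type) [Field K] [Algebra A K] [IsFractionRing A K]
  {X XK : Scheme.{0}} (q : X ⟶ Spec (.of A)) [LocallyOfFiniteType q] [QuasiCompact q]
  {jK : XK ⟶ X} {qK : XK ⟶ Spec (.of K)} (HK : IsPullback jK qK q (specOfAlgebra A K))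

include HK in
/-- ★ **Spread of an ideal inclusion, packaged**: if `I.comap j_K ≤ J.comap j_K` on the generic fibre of the finite-type `A`-scheme `X` (`A` a
Noetherian domain), then there is `a ≠ 0` such that `I.comap ι_B ≤ J.comap ι_B` for every `A`-algebra `B` in which `a` is a unit and every cartesian
square `X_B = X ×_A Spec B`: ✓ `exists_comap_ι_le_comap_ι_of_generic` gives the inclusion over `q⁻¹D(a)`, through which `ι_B` factors
(Mathlib `IsOpenImmersion.lift`; ✓ `specMap_mem_basicOpen_of_isUnit`), and `comap` is functorial and monotone.
[cite: Grothendieck1966, EGA IV₃ §8–§9] [OURS · L1 W4.5b · RUNG LC (B3′)(s3) packaging; EL♮(3) NOT proved] -/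
theorem exists_forall_comap_le_comap (I J : X.IdealSheafData) (hle : I.comap jK ≤ J.comap jK) :
    ∃ a : A, a ≠ 0 ∧ ∀ (B : Type) [CommRing B] [Algebra A B], IsUnit (algebraMap A B a) →
      ∀ {XB : Scheme.{0}} (ιB : XB ⟶ X) (qB : XB ⟶ Spec (.of B)), IsPullback ιB qB q (specOfAlgebra A B) →
        I.comap ιB ≤ J.comap ιB := by
  haveI : IsLocallyNoetherian X := LocallyOfFiniteType.isLocallyNoetherian q
  haveI : CompactSpace X := QuasiCompact.compactSpace_of_compactSpace q
  -- the inclusion on Mathlib's chosen generic fibre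
  have hle' : I.comap (pullback.fst q (specOfAlgebra A K)) ≤ J.comap (pullback.fst q (specOfAlgebra A K)) := by
    rw [comap_pullback_fst_eq_comap_comap K q HK, comap_pullback_fst_eq_comap_comap K q HK]
    exact comap_mono _ hle
  obtain ⟨a, ha, h⟩ := exists_comap_ι_le_comap_ι_of_generic K q I J hle'
  refine ⟨a, ha, fun B _ _ hunit XB ιB qB HX => ?_⟩
  -- `ι_B` factors through the open `q⁻¹ D(a)`
  set U : X.Opens := q ⁻¹ᵁ (PrimeSpectrum.basicOpen a) with hU
  have hrange : Set.range ιB ⊆ Set.range U.ι := by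
    rw [Scheme.Opens.range_ι]
    rintro _ ⟨y, rfl⟩
    show q (ιB y) ∈ PrimeSpectrum.basicOpen a
    rw [← Scheme.Hom.comp_apply, HX.w, Scheme.Hom.comp_apply]
    exact specMap_mem_basicOpen_of_isUnit B hunit _
  set L : XB ⟶ U := IsOpenImmersion.lift U.ι ιB hrange with hL
  have hfac : L ≫ U.ι = ιB := IsOpenImmersion.lift_fac _ _ hrange
  rw [← hfac, comap_comp, comap_comp]
  exact comap_mono _ h

end Spread

end Summit.ResolutionOfSingularities.ResolutionOfSingularities.Cruxes.EquisingularLiftNat.Sections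

end
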